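import Summits.ResolutionOfSingularities.ResolutionOfSingularities.Theorems.EquisingularLiftEquisingularLiftOrdinaryPointsLinearParts
import Summits.ResolutionOfSingularities.ResolutionOfSingularities.Theorems.EquisingularLiftEquisingularLiftOrdinaryPointAnywhere
import HarnessLib

/-!
# [OURS] ★★★ ORDINARY MULTIPLE POINTS IN LINEARLY GENERAL POSITION — INTRINSIC HYPOTHESES, BOTH CURRENCIES, EVERY DIMENSION AND CHARACTERISTIC
# (cruxes `EquisingularLift` stmt-…-15660: regular blow-up models; `EquisingularLiftNat(Three)` stmt-…-20038 / -20148: `ELNatAt`)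

[OURS · leafhand-res-equisingularlift-7 g1, 2026-08-31; cell `pub/decomp-res`] AI-produced, weaker than expert review; NOT a statement of any manuscript;
nothing here proves resolution of singularities in positive characteristic.  DEF-FREE helper; no `sorry`; standard axioms; ZERO named hypotheses.

The ordinary-points family with the data a geometer actually has: marked points `P_c = [b_c]` (`c ∈ S`, `(b_c)_c = 1`), at each of them the chart equation
of `F` TRANSLATED to the point, `F(x_c := 1)(y + b_c') = Φ_c + Ψ_c` with `Φ_c` a NONSINGULAR form of degree `μ_c ≥ 1` (the tangent cone) and `Ψ_c ∈ (y)^{μ_c+1}`,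
the global Jacobian condition «every singular point of `V₊(F)` is one of the `P_c`», and ONE auxiliary invertible linear change of coordinates `τ, τ'` whose
new vertices are the marked points (`τ'(e_c) ∈ K·b_c` — pure linear algebra: any matrix with the `b_c` among its columns).  NO chart computation in the new
coordinates is asked for: the tangent cone is transported by the tree's tools (✓ `dehomogenize_aeval_eq_initial_add`, ✓ `aeval_linearPart_linearPart`,
✓ `isNonsingularForm_aeval_of_linSubst`, ✓ `dehomogenize_shear_eq_translate`).

* `MultiOrd.ne_zero_of_isNonsingularForm` — a nonsingular form is `≠ 0`;
* ★ `MultiOrd.ord_linSubst_of_translatedChart` — THE TRANSPORT: from the translated chart `Φ + Ψ` of `F` at `P_c = [b_c] = [τ'(e_c)]` to the vertex chart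
  `σ_{τ'}F(x_c := 1) = Φ' + Ψ'` with `Φ' = λ^{d−μ}·Φ(M)` nonsingular of the same degree `μ` (`M` the linear part of `shear_{b_c}⁻¹ ∘ τ'` at `e_c`, invertible);
* ★★★ `MultiOrd.elNatAt_of_ordinaryPoints_at` — **EL♮ (`ELNatAt`) for every `(H, ι)`, `range ι = V₊(F)`, `F` a prime form over `K = K̄` of characteristic `p`,
  whose singular points are marked points `P_c`, `c ∈ S`, in linearly general position (witnessed by `τ, τ'`), each an ORDINARY MULTIPLE POINT (translated
  chart)** — any dimension, any degree;
* ★★★ `StrataSplit.blowupModel_of_ordinaryPoints_at` — the same `H` has a regular blow-up model (conclusion of the OPEN residual `stub_blowupModel_ge_five`).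

E.g. every hypersurface whose singular points are `≤ m + 3` nodes in linearly general position; classically every cubic surface with only `A₁` points
(granted the classical — here unformalised — fact that its `≤ 4` nodes are in general position).  Honest label: closes no registered stub.

References: [Hartshorne1977, I Thm. 5.1, I Ex. 5.8, II Example 7.1.1, II Ex. 7.12]; [Matsumura1987, §14]; [StacksProject, Tags 07PF, 080A].
-/

set_option linter.dupNamespace false -- mandated namespace `Summit.<Summit>.<Problem>` of this single-conjunct summit

noncomputable section

open CategoryTheory CategoryTheory.Limits AlgebraicGeometry TopologicalSpace
open MvPolynomial
open Literature.AlgebraicGeometry.Resolution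
open Literature.AlgebraicGeometry.Motives Literature.AlgebraicGeometry.Motives.SmoothHypersurface
open Literature.AlgebraicGeometry.Motives.ProjectiveSpace

namespace Summit.ResolutionOfSingularities.ResolutionOfSingularities.Cruxes.EquisingularLiftNat.Sections

namespace MultiOrd

variable {K : Type} [Field K]

/-- A nonsingular form is non-zero (the zero ideal is prime and contains no variable). [folklore] -/
theorem ne_zero_of_isNonsingularForm {n : ℕ} {Φ : MvPolynomial (Fin (n + 2)) K} (hΦ : IsNonsingularForm K Φ) : Φ ≠ 0 := by
  rintro rfl
  have h := hΦ ⊥ Ideal.isPrime_bot (Submodule.zero_mem _) (fun j => by rw [map_zero]; exact Submodule.zero_mem _) 0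
  exact X_ne_zero (0 : Fin (n + 2)) (Ideal.mem_bot.mp h)

/-- ★ **Transport of the ordinary-point datum from the translated chart of `F` at `[τ'(e_c)]` to the vertex chart of `σ_{τ'} F` at `e_c`.**
`τ, τ'` mutually inverse linear substitutions; `b` with `b_c = 1` and `τ'(e_c) = λ·b` (`λ = τ'_c(e_c)`); `F` a form of degree `d` whose chart `F(x_c:=1)`
translated to `b'` is `Φ + Ψ`, `Φ` a nonsingular form of degree `μ ≥ 1`, `Ψ ∈ (y)^{μ+1}`.  Then `σ_{τ'}F(x_c := 1) = Φ' + Ψ'` with `Φ'` a nonsingular form of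
degree `μ` and `Ψ' ∈ (y)^{μ+1}`.  Proof: `σ_{τ'} F = σ*P` for `P = shear_b*F` (vertex chart `Φ + Ψ`, ✓ `dehomogenize_shear_eq_translate`) and
`σ = τ' ∘ shear_b⁻¹` fixing `[e_c]`; ✓ `dehomogenize_aeval_eq_initial_add` gives `Φ' = λ^{d−μ} Φ(M)`, and `M` is invertible (✓ `aeval_linearPart_linearPart`),
so `Φ(M)` is nonsingular (✓ `isNonsingularForm_aeval_of_linSubst`). [cite: Hartshorne1977, I Ex. 5.8, II Example 7.1.1] [cite: Matsumura1987, §14] -/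
theorem ord_linSubst_of_translatedChart [IsAlgClosed K] {m : ℕ} (c : Fin (m + 2 + 1))
    (τ τ' : Fin (m + 2 + 1) → MvPolynomial (Fin (m + 2 + 1)) K) (hτ : ∀ i, (τ i).IsHomogeneous 1) (hτ' : ∀ i, (τ' i).IsHomogeneous 1)
    (hinv : ∀ i, aeval τ (τ' i) = X i) (hinv' : ∀ i, aeval τ' (τ i) = X i)
    (b : Fin (m + 2 + 1) → K) (hb1 : b c = 1)
    (hbτ : ∀ i, eval (Pi.single c 1 : Fin (m + 2 + 1) → K) (τ' i) = eval (Pi.single c 1 : Fin (m + 2 + 1) → K) (τ' c) * b i)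
    (F : MvPolynomial (Fin (m + 2 + 1)) K) {d : ℕ} (hF : F.IsHomogeneous d)
    {μ : ℕ} {Φ Ψ : MvPolynomial (Fin (m + 2)) K} (hΦ : Φ.IsHomogeneous μ) (hns : IsNonsingularForm K Φ)
    (hΨ : Ψ ∈ Ideal.span (Set.range (X : Fin (m + 2) → MvPolynomial (Fin (m + 2)) K)) ^ (μ + 1))
    (heq : aeval (fun j : Fin (m + 2) => (X j : MvPolynomial (Fin (m + 2)) K) + C (b (c.succAbove j))) (ProjectiveSpace.dehomogenize K c F) = Φ + Ψ) :
    ∃ (Φ' Ψ' : MvPolynomial (Fin (m + 2)) K), Φ'.IsHomogeneous μ ∧ IsNonsingularForm K Φ' ∧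
      Ψ' ∈ Ideal.span (Set.range (X : Fin (m + 2) → MvPolynomial (Fin (m + 2)) K)) ^ (μ + 1) ∧
        ProjectiveSpace.dehomogenize K c (aeval τ' F) = Φ' + Ψ' := by
  classical
  -- the shear moving `b` to `e_c`, its inverse, the sheared form `P` and the vertex-fixing substitutions `σ`, `σ'`
  set sh : Fin (m + 2 + 1) → MvPolynomial (Fin (m + 2 + 1)) K :=
    fun i => if i = c then (X c : MvPolynomial (Fin (m + 2 + 1)) K) else X i + C (1 * b i) * X c with hsh
  set ush : Fin (m + 2 + 1) → MvPolynomial (Fin (m + 2 + 1)) K :=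
    fun i => if i = c then (X c : MvPolynomial (Fin (m + 2 + 1)) K) else X i + C (-1 * b i) * X c with hush
  set P := aeval sh F with hPdef
  set σ : Fin (m + 2 + 1) → MvPolynomial (Fin (m + 2 + 1)) K := fun i => aeval τ' (ush i) with hσ
  set σ' : Fin (m + 2 + 1) → MvPolynomial (Fin (m + 2 + 1)) K := fun i => aeval sh (τ i) with hσ'
  set e : Fin (m + 2 + 1) → K := Pi.single c 1 with he
  set lam : K := eval e (τ' c) with hlam
  have hush_sh : ∀ i, aeval ush (sh i) = X i := fun i => by
    have h := aeval_shear_shear c b 1 i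
    rwa [show (-(1 : K)) = -1 from rfl] at h
  have hsh_ush : ∀ i, aeval sh (ush i) = X i := fun i => by
    have h := aeval_shear_shear c b (-1) i
    rwa [neg_neg] at h
  have hshlin : ∀ i, (sh i).IsHomogeneous 1 := isHomogeneous_shear c b 1
  have hushlin : ∀ i, (ush i).IsHomogeneous 1 := isHomogeneous_shear c b (-1)
  have hP : P.IsHomogeneous d := by
    have h := hF.aeval sh hshlin
    rwa [one_mul] at h
  have hdehP : ProjectiveSpace.dehomogenize K c P = Φ + Ψ := by
    rw [hPdef, dehomogenize_shear_eq_translate]; exact heq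
  -- compositions
  have hσsh : ∀ l, aeval σ (sh l) = τ' l := fun l => by
    rw [hσ, ← MvPolynomial.comp_aeval, AlgHom.comp_apply, hush_sh, aeval_X]
  have hσ'τ' : ∀ l, aeval σ' (τ' l) = sh l := fun l => by
    rw [hσ', ← MvPolynomial.comp_aeval, AlgHom.comp_apply, hinv, aeval_X]
  have hG : aeval σ P = aeval τ' F := by
    rw [hPdef, ← AlgHom.comp_apply, MvPolynomial.comp_aeval, show (fun i => aeval σ (sh i)) = τ' from funext hσsh]
  have hinvσ : ∀ i, aeval σ (σ' i) = X i := fun i => by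
    show aeval σ (aeval sh (τ i)) = X i
    rw [← AlgHom.comp_apply, MvPolynomial.comp_aeval, show (fun l => aeval σ (sh l)) = τ' from funext hσsh, hinv']
  have hinvσ' : ∀ i, aeval σ' (σ i) = X i := fun i => by
    show aeval σ' (aeval τ' (ush i)) = X i
    rw [← AlgHom.comp_apply, MvPolynomial.comp_aeval, show (fun l => aeval σ' (τ' l)) = sh from funext hσ'τ', hsh_ush]
  have hσlin : ∀ i, (σ i).IsHomogeneous 1 := fun i => by
    have h := (hushlin i).aeval τ' hτ'
    rwa [one_mul] at h
  have hσ'lin : ∀ i, (σ' i).IsHomogeneous 1 := fun i => by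
    have h := (hτ i).aeval sh hshlin
    rwa [one_mul] at h
  -- `σ` fixes the vertex: `σ_i(e_c) = τ'_i(e_c) - b_i τ'_c(e_c) = 0`
  have hσe : ∀ i, i ≠ c → eval e (σ i) = 0 := fun i hi => by
    have h1 : σ i = τ' i + C (-1 * b i) * τ' c := by
      simp only [hσ, hush, if_neg hi, map_add, map_mul, aeval_X, aeval_C, MvPolynomial.algebraMap_eq]
    rw [h1, map_add, map_mul, eval_C, hbτ i]
    ring
  have hσfix : ∀ i, i ≠ c → constantCoeff (ProjectiveSpace.dehomogenize K c (σ i)) = 0 := fun i hi => by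
    rw [constantCoeff_dehomogenize]; exact hσe i hi
  -- `λ ≠ 0`
  have hlam0 : lam ≠ 0 := by
    intro h0
    have hall : ∀ j, eval e (τ' j) = 0 := fun j => by rw [hbτ j, h0, zero_mul]
    have h1 := eval_linSubst_point τ τ' hinv' e c
    rw [show (fun j => eval e (τ' j)) = (0 : Fin (m + 2 + 1) → K) from funext fun j => by rw [hall j]; rfl,
      eval_zero_of_isHomogeneous_one (hτ c), he, Pi.single_eq_same] at h1
    exact zero_ne_one h1
  -- `σ'` fixes the vertex: `σ'_i(e_c) = τ_i(sh(e_c)) = τ_i(b) = λ⁻¹ τ_i(τ'(e_c)) = λ⁻¹ δ_{ic}`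
  have hshe : (fun l => eval e (sh l)) = b := by
    funext l
    by_cases hl : l = c
    · subst hl
      simp only [hsh, if_pos rfl, eval_X, he, Pi.single_eq_same, hb1]
    · simp only [hsh, if_neg hl, map_add, map_mul, eval_X, eval_C, he, Pi.single_eq_same, Pi.single_eq_of_ne hl]
      ring
  have hbe : b = lam⁻¹ • fun j => eval e (τ' j) := by
    funext i
    rw [Pi.smul_apply, smul_eq_mul, hbτ i, ← mul_assoc, inv_mul_cancel₀ hlam0, one_mul]
  have hσ'e : ∀ i, i ≠ c → eval e (σ' i) = 0 := fun i hi => by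
    show eval e (aeval sh (τ i)) = 0
    rw [eval_aeval_eq_eval, hshe, hbe, eval_smul_of_isHomogeneous_one (hτ i), eval_linSubst_point τ τ' hinv' e i, he,
      Pi.single_eq_of_ne hi, mul_zero]
  -- linear parts `M`, `M'` and their mutual inverse relations
  set M : Fin (m + 2) → MvPolynomial (Fin (m + 2)) K := fun j => ProjectiveSpace.dehomogenize K c (σ (c.succAbove j)) with hM
  set M' : Fin (m + 2) → MvPolynomial (Fin (m + 2)) K := fun j => ProjectiveSpace.dehomogenize K c (σ' (c.succAbove j)) with hM'
  have hM'lin : ∀ j, (M' j).IsHomogeneous 1 := fun j =>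
    isHomogeneous_one_dehomogenize c (hσ'lin _) (hσ'e _ (Fin.succAbove_ne c j))
  have hMlin : ∀ j, (M j).IsHomogeneous 1 := fun j =>
    isHomogeneous_one_dehomogenize c (hσlin _) (hσe _ (Fin.succAbove_ne c j))
  have hMM' : ∀ j, aeval M (M' j) = X j := fun j => aeval_linearPart_linearPart c σ σ' hσ'lin hinvσ hσ'e j
  have hM'M : ∀ j, aeval M' (M j) = X j := fun j => aeval_linearPart_linearPart c σ' σ hσlin hinvσ' hσe j
  have hnsM : IsNonsingularForm K (aeval M Φ) := isNonsingularForm_aeval_of_linSubst M' M hM'lin hM'M hMM' hns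
  -- `μ ≤ d`
  have hμd : μ ≤ d := by
    by_contra hlt
    push Not at hlt
    obtain ⟨hQμ, -⟩ := homogeneousComponent_add_of_mem_pow hΦ hΨ
    have h0 : homogeneousComponent μ (ProjectiveSpace.dehomogenize K c P) = 0 :=
      homogeneousComponent_eq_zero μ _ (lt_of_le_of_lt (totalDegree_dehomogenize_le c hP) hlt)
    rw [hdehP, hQμ] at h0
    exact ne_zero_of_isNonsingularForm hns h0
  -- the expansion
  obtain ⟨Ψ', hΨ', hexp⟩ := dehomogenize_aeval_eq_initial_add c hP hΦ hΨ hμd hdehP σ hσfix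
  have hlam' : constantCoeff (ProjectiveSpace.dehomogenize K c (σ c)) = lam := by
    rw [constantCoeff_dehomogenize, hlam]
    show eval (Pi.single c 1) (aeval τ' (ush c)) = eval e (τ' c)
    simp only [hush, if_pos rfl, aeval_X, he]
  refine ⟨C (lam ^ (d - μ)) * aeval M Φ, Ψ', ?_, isNonsingularForm_C_mul hnsM (pow_ne_zero _ hlam0), hΨ', ?_⟩
  · have h1 := hΦ.aeval M hMlin
    have h2 := (isHomogeneous_C (Fin (m + 2)) (lam ^ (d - μ))).mul h1
    simpa using h2
  · rw [← hG, hexp, hlam']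

/-- ★★★ **EL♮ FOR HYPERSURFACES WHOSE SINGULAR POINTS ARE ORDINARY MULTIPLE POINTS IN LINEARLY GENERAL POSITION — intrinsic hypotheses, every dimension,
degree and characteristic.**  `K = K̄` of characteristic `p`; `ι : H ↪ ℙ^{m+2}_K` with `range ι = V₊(F)`, `F` a prime form of degree `d`; marked points
`b_c` (`c ∈ S`, `S` duplicate-free, `(b_c)_c = 1`); `τ, τ'` mutually inverse linear substitutions with `τ'(e_c) ∈ K·b_c` (`τ'_i(e_c) = τ'_c(e_c)·(b_c)_i`);
(ordF) at each `b_c` the translated chart `F(x_c := 1)(y + b_c') = Φ_c + Ψ_c` with `Φ_c` a NONSINGULAR form of degree `μ_c ≥ 1`, `Ψ_c ∈ (y)^{μ_c+1}`;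
(jacF) every `b₁ ≠ 0` with `F(b₁) = 0`, `∇F(b₁) = 0` has `τ_i(b₁) = 0` for all `i ≠ c`, for some `c ∈ S` (i.e. `[b₁] = [b_c]`).  Then
`Theorems.EquisingularLift.ELNatAt p K (m+2) H ι` — witness `O = 𝕎(K)`, ONE blow-up of `ℙ^{m+2}_O` along the product of the `O`-points through the `b_c`.
[OURS · L1 W4.5b] [cite: Hartshorne1977, I Thm. 5.1, II Example 7.1.1] [cite: StacksProject, Tag 080A] -/
theorem elNatAt_of_ordinaryPoints_at (p : ℕ) (hp : p.Prime) [CharP K p] [IsAlgClosed K] {m : ℕ}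
    {H : Scheme.{0}} (ι : H ⟶ (projectiveSpace (m + 1 + 1) K).left) [IsClosedImmersion ι]
    (F : MvPolynomial (Fin (m + 1 + 1 + 1)) K) {d : ℕ} (hF : F.IsHomogeneous d) (hFp : Prime F)
    (hrange : letI := MvPolynomial.gradedAlgebra (σ := Fin (m + 1 + 1 + 1)) (R := K)
      Set.range ι = {x : Proj (homogeneousSubmodule (Fin (m + 1 + 1 + 1)) K) | F ∈ x.asHomogeneousIdeal})
    (τ τ' : Fin (m + 1 + 1 + 1) → MvPolynomial (Fin (m + 1 + 1 + 1)) K) (hτ : ∀ i, (τ i).IsHomogeneous 1) (hτ' : ∀ i, (τ' i).IsHomogeneous 1)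
    (hinv : ∀ i, aeval τ (τ' i) = X i) (hinv' : ∀ i, aeval τ' (τ i) = X i)
    (S : List (Fin (m + 2 + 1))) (hS : S.Nodup) (b : Fin (m + 2 + 1) → Fin (m + 2 + 1) → K) (hb1 : ∀ c ∈ S, b c c = 1)
    (hbτ : ∀ c ∈ S, ∀ i, eval (Pi.single c 1 : Fin (m + 2 + 1) → K) (τ' i) = eval (Pi.single c 1 : Fin (m + 2 + 1) → K) (τ' c) * b c i)
    (hordF : ∀ c ∈ S, ∃ (μ : ℕ) (Φ Ψ : MvPolynomial (Fin (m + 2)) K), 1 ≤ μ ∧ Φ.IsHomogeneous μ ∧ IsNonsingularForm K Φ ∧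
      Ψ ∈ Ideal.span (Set.range (X : Fin (m + 2) → MvPolynomial (Fin (m + 2)) K)) ^ (μ + 1) ∧
        aeval (fun j : Fin (m + 2) => (X j : MvPolynomial (Fin (m + 2)) K) + C (b c (c.succAbove j))) (ProjectiveSpace.dehomogenize K c F) = Φ + Ψ)
    (hjacF : ∀ b₁ : Fin (m + 2 + 1) → K, b₁ ≠ 0 → eval b₁ F = 0 → (∀ j, eval b₁ (pderiv j F) = 0) →
      ∃ c ∈ S, ∀ i, i ≠ c → eval b₁ (τ i) = 0) :
    Theorems.EquisingularLift.ELNatAt p K (m + 1 + 1) H ι := by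
  refine elNatAt_of_linSubst_ordinaryPoints_of_jacobian' p hp ι F hF hFp hrange τ τ' hτ hτ' hinv hinv' S hS (fun c hc => ?_) hjacF
  obtain ⟨μ, Φ, Ψ, hμ, hΦ, hns, hΨ, heq⟩ := hordF c hc
  obtain ⟨Φ', Ψ', hΦ', hns', hΨ', heq'⟩ :=
    ord_linSubst_of_translatedChart c τ τ' hτ hτ' hinv hinv' (b c) (hb1 c hc) (hbτ c hc) F hF hΦ hns hΨ heq
  exact ⟨μ, Φ', Ψ', hμ, hΦ', hns', hΨ', heq'⟩

end MultiOrd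

end Summit.ResolutionOfSingularities.ResolutionOfSingularities.Cruxes.EquisingularLiftNat.Sections

namespace Summit.ResolutionOfSingularities.ResolutionOfSingularities.Cruxes.EquisingularLift.StrataSplit

open Summit.ResolutionOfSingularities.ResolutionOfSingularities.Cruxes.EquisingularLiftNat.Sections

/-- ★★★ **Hypersurfaces whose singular points are ordinary multiple points in linearly general position have regular blow-up models — intrinsic hypotheses**
(`K = K̄`, any characteristic, any dimension, any degree): hypotheses of ✓ `MultiOrd.elNatAt_of_ordinaryPoints_at`; conclusion = that of the OPEN residual
`stub_blowupModel_ge_five` at `H`. [cite: Hartshorne1977, I Thm. 5.1, II Example 7.1.1, II Ex. 7.12] -/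
theorem blowupModel_of_ordinaryPoints_at {K : Type} [Field K] [IsAlgClosed K] {m : ℕ} {H : Scheme.{0}}
    (ι : H ⟶ (projectiveSpace (m + 1 + 1) K).left) [IsClosedImmersion ι] [IsIntegral H]
    (F : MvPolynomial (Fin (m + 1 + 1 + 1)) K) {d : ℕ} (hF : F.IsHomogeneous d) (hFp : Prime F)
    (hrange : letI := MvPolynomial.gradedAlgebra (σ := Fin (m + 1 + 1 + 1)) (R := K)
      Set.range ι = {x : Proj (homogeneousSubmodule (Fin (m + 1 + 1 + 1)) K) | F ∈ x.asHomogeneousIdeal})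
    (τ τ' : Fin (m + 1 + 1 + 1) → MvPolynomial (Fin (m + 1 + 1 + 1)) K) (hτ : ∀ i, (τ i).IsHomogeneous 1) (hτ' : ∀ i, (τ' i).IsHomogeneous 1)
    (hinv : ∀ i, aeval τ (τ' i) = X i) (hinv' : ∀ i, aeval τ' (τ i) = X i)
    (S : List (Fin (m + 2 + 1))) (hS : S.Nodup) (b : Fin (m + 2 + 1) → Fin (m + 2 + 1) → K) (hb1 : ∀ c ∈ S, b c c = 1)
    (hbτ : ∀ c ∈ S, ∀ i, eval (Pi.single c 1 : Fin (m + 2 + 1) → K) (τ' i) = eval (Pi.single c 1 : Fin (m + 2 + 1) → K) (τ' c) * b c i)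
    (hordF : ∀ c ∈ S, ∃ (μ : ℕ) (Φ Ψ : MvPolynomial (Fin (m + 2)) K), 1 ≤ μ ∧ Φ.IsHomogeneous μ ∧ IsNonsingularForm K Φ ∧
      Ψ ∈ Ideal.span (Set.range (X : Fin (m + 2) → MvPolynomial (Fin (m + 2)) K)) ^ (μ + 1) ∧
        aeval (fun j : Fin (m + 2) => (X j : MvPolynomial (Fin (m + 2)) K) + C (b c (c.succAbove j))) (ProjectiveSpace.dehomogenize K c F) = Φ + Ψ)
    (hjacF : ∀ b₁ : Fin (m + 2 + 1) → K, b₁ ≠ 0 → eval b₁ F = 0 → (∀ j, eval b₁ (pderiv j F) = 0) →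
      ∃ c ∈ S, ∀ i, i ≠ c → eval b₁ (τ i) = 0) :
    ∃ 𝔞 : H.IdealSheafData, 𝔞 ≠ ⊥ ∧ ∀ (Z : Scheme.{0}) (π : Z ⟶ H), IsBlowup π 𝔞 → Scheme.IsRegular Z := by
  refine blowupModel_of_range_eq_of_linSubst_ordinaryPoints_of_jacobian' ι F hF hFp hrange τ τ' hτ hτ' hinv hinv' S hS (fun c hc => ?_) hjacF
  obtain ⟨μ, Φ, Ψ, hμ, hΦ, hns, hΨ, heq⟩ := hordF c hc
  obtain ⟨Φ', Ψ', hΦ', hns', hΨ', heq'⟩ :=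
    MultiOrd.ord_linSubst_of_translatedChart c τ τ' hτ hτ' hinv hinv' (b c) (hb1 c hc) (hbτ c hc) F hF hΦ hns hΨ heq
  exact ⟨μ, Φ', Ψ', hμ, hΦ', hns', hΨ', heq'⟩

end Summit.ResolutionOfSingularities.ResolutionOfSingularities.Cruxes.EquisingularLift.StrataSplit

end
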